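import Summits.ResolutionOfSingularities.ResolutionOfSingularities.Theorems.PurelyInseparableDim4EquimultipleChart
import HarnessLib

/-!
# Purely inseparable four-folds: WHICH points of the blow-up carry the transform — the `z`-chart is idle, every
# point of the transform over the centre lies in an `x_j`-chart, `j ∈ S` (brick TY-3e «POINTS», cell `res-dim4-pi`)

[OURS · counted 0] (D-0157 DOOR 2; continues TY-3/TY-3c and typ-2's TY-2 (b) `PurelyInseparableDim4ChartTransfer`;
host item stmt-ResolutionOfSingularities-16155, helper). Nothing here proves resolution of singularities in
dimension ≥ 4 / characteristic `p`.

Setting: `π : W → 𝔸⁵_K` ANY blowing up along `V(z, x_S)` (`IsBlowup π 𝓘Λ`, `Λ_S = {z} ∪ x_S`), `p ≤ ord_{(x_S)} F`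
(Hironaka-permissibility of the centre for `z^p + F`). The blow-up is covered by the `|S| + 1` charts `W[⊤, z]` and
`W[⊤, x_j]` (`j ∈ S`) of the tree (`AffineCoordBlowup.chartImm`, `iSup_opensRange_chartImm`). TY-2/TY-3 describe the
transform on the `x_j`-charts; this file disposes of the `z`-CHART and proves the COVERING statement the cell's
line needs for S3 (b): every point of the transform lying over the centre is seen by some `x_j`-chart, `j ∈ S`.

* §1 ring: `coordBlowupSubst_zero_rename_monomial`, `exists_coordBlowupSubst_zero_hyp` — on the `z`-chart
  (`ψ₀ : z ↦ z, xᵢ ↦ z·xᵢ (i ∈ S)`) the total transform is `ψ₀(z^p + F) = z^p · (1 + T)` with `T ∈ (xᵢ : i ∈ S)`.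
* §2 sheaves: `exists_controlledTransform_comap_chartImm_zero` — `σᶜ((z^p + F)·𝒪, p)|_{z-chart} = (1 + T)·𝒪`;
  `one_le_idealOrder_ofIdealTop_span_iff` (support of a principal ideal sheaf of `𝔸⁵` at a point);
  **`exists_X_succ_not_mem_of_one_le_idealOrder`** — a point of the `z`-chart at which the controlled transform
  has positive order has `xⱼ ∉ 𝔭` for some `j ∈ S` (else `1 + T ∈ 𝔭 ⊇ (x_S) ∋ T`).

Deliberately NOT here (next file of the brick): the chart-overlap lemma «a point of the `z`-chart with `xⱼ ∉ 𝔭`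
lies in `W[⊤, x_j]`» and the synthesis with TY-3c. AI-produced formalisation, weaker than expert review.
bears_on: LADDER-RESOLUTION:D157-DOOR2 (res-dim4-pi · TY-3e).
-/

set_option linter.dupNamespace false -- D-0017: single-problem summit path `Summit.<S>.<S>.…` by design

noncomputable section

open MvPolynomial Finset CategoryTheory AlgebraicGeometry Opposite
open AlgebraicGeometry.Scheme.IdealSheafData (ofIdealTop)

namespace Summit.ResolutionOfSingularities.ResolutionOfSingularities.Theorems.PIDim4

open Literature.AlgebraicGeometry.Resolution
open Literature.AlgebraicGeometry.Resolution.Hauser2010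
open Literature.AlgebraicGeometry.Resolution.AffinePointBlowup (P A γ coord Wtop)
open Literature.AlgebraicGeometry.Hironaka2017.SpecOrders (shf)

namespace Equimultiple

/-! ## §1 The `z`-chart substitution on `z^p + F` -/

section Ring

variable {K : Type} [Field K]

/-- The centre variables `Λ_S = {z} ∪ x_S` as the coercion of a finset (bookkeeping for the tree's
`coordBlowupSubst_monomial`, which is stated over finsets). [folklore] -/
theorem centreVars_eq_coe (S : Finset (Fin 4)) :
    (insert 0 (Fin.succ '' (S : Set (Fin 4))) : Set (Fin (4 + 1))) =
      ((insert 0 (S.map (Fin.succEmb 4)) : Finset (Fin (4 + 1))) : Set (Fin (4 + 1))) := by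
  rw [Finset.coe_insert, Finset.coe_map]
  rfl

/-- **The `z`-chart on a monomial of the base variables**: `ψ₀(c · x^d) = c · z^{Σ_{i ∈ S} dᵢ} · x^d`
(`ψ₀ : z ↦ z`, `xᵢ ↦ z·xᵢ` for `i ∈ S`, `xᵢ ↦ xᵢ` otherwise). [cite: HauserPerlega2019PRIMS, §2 (charts of the blowup)] -/
theorem coordBlowupSubst_zero_rename_monomial (S : Finset (Fin 4)) (d : Fin 4 →₀ ℕ) (c : K) :
    coordBlowupSubst K (insert 0 (Fin.succ '' (S : Set (Fin 4)))) 0 (rename Fin.succ (monomial d c)) =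
      monomial (Finsupp.single 0 (CentreBlowup.degIn S d) + Finsupp.mapDomain Fin.succ d) c := by
  rw [rename_monomial, centreVars_eq_coe, ChartDictionary.coordBlowupSubst_monomial,
    Finset.erase_insert (by simp), Finset.sum_map]
  have hsum : ∑ x ∈ S, (Finsupp.mapDomain Fin.succ d) ((Fin.succEmb 4) x) = CentreBlowup.degIn S d := by
    rw [CentreBlowup.degIn]
    refine Finset.sum_congr rfl fun i _ => ?_
    rw [Fin.coe_succEmb]
    exact Finsupp.mapDomain_apply (Fin.succ_injective 4) d i
  rw [hsum]

/-- **The total transform of `z^p + F` on the `z`-chart**: if every monomial of `F` has `x_S`-degree `≥ p`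
(`p ≤ ord_{(x_S)} F`, `p ≠ 0`), then `ψ₀(z^p + F) = z^p · (1 + T)` with `T` in the ideal `(xᵢ : i ∈ S)` of the strict
transforms of the centre's hyperplanes (explicitly `T = Σ_d c_d z^{|d|_S − p} x^d`).
[cite: HauserPerlega2019PRIMS, §2 (charts of the blowup)] -/
theorem exists_coordBlowupSubst_zero_hyp {p : ℕ} (hp : p ≠ 0) {S : Finset (Fin 4)} (F : MvPolynomial (Fin 4) K)
    (hperm : (p : ℕ∞) ≤ CentreBlowup.ordAlong S F) :
    ∃ T : MvPolynomial (Fin (4 + 1)) K,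
      T ∈ Ideal.span ((fun j : Fin 4 => (X j.succ : MvPolynomial (Fin (4 + 1)) K)) '' (S : Set (Fin 4))) ∧
        coordBlowupSubst K (insert 0 (Fin.succ '' (S : Set (Fin 4)))) 0 (hyp p F) = X 0 ^ p * (1 + T) := by
  classical
  refine ⟨∑ d ∈ F.support, monomial (Finsupp.single 0 (CentreBlowup.degIn S d - p) +
      Finsupp.mapDomain Fin.succ d) (coeff d F), ?_, ?_⟩
  · -- every monomial of `T` is divisible by some `x_j`, `j ∈ S`
    refine Ideal.sum_mem _ fun d hd => ?_
    have hq : p ≤ CentreBlowup.degIn S d := by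
      have h : CentreBlowup.ordAlong S F ≤ (CentreBlowup.degIn S d : ℕ∞) := Finset.inf_le hd
      exact_mod_cast hperm.trans h
    obtain ⟨j, hjS, hj⟩ : ∃ j ∈ S, d j ≠ 0 := by
      by_contra hall
      push Not at hall
      have : CentreBlowup.degIn S d = 0 := Finset.sum_eq_zero hall
      omega
    have hle : Finsupp.single j.succ 1 ≤ Finsupp.single 0 (CentreBlowup.degIn S d - p) +
        Finsupp.mapDomain Fin.succ d := by
      refine Finsupp.le_def.mpr fun i => ?_
      by_cases hi : i = j.succ
      · subst hi
        rw [Finsupp.single_eq_same, Finsupp.add_apply, Finsupp.mapDomain_apply (Fin.succ_injective 4)]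
        have : 1 ≤ d j := Nat.one_le_iff_ne_zero.mpr hj
        omega
      · rw [Finsupp.single_apply, if_neg (Ne.symm hi)]
        exact Nat.zero_le _
    obtain ⟨e, he⟩ := exists_add_of_le hle
    have hmono : monomial (Finsupp.single j.succ 1 + e) (coeff d F) =
        (X j.succ : MvPolynomial (Fin (4 + 1)) K) * monomial e (coeff d F) := by
      rw [X, monomial_mul, one_mul]
    rw [he, hmono]
    exact Ideal.mul_mem_right _ _ (Ideal.subset_span ⟨j, hjS, rfl⟩)
  · -- `ψ₀ (z^p + F) = z^p + Σ_d c_d z^{|d|_S} x^d = z^p (1 + T)`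
    rw [hyp, map_add, map_pow, coordBlowupSubst_X_self, mul_add, mul_one, Finset.mul_sum]
    congr 1
    conv_lhs => rw [F.as_sum, map_sum, map_sum]
    refine Finset.sum_congr rfl fun d hd => ?_
    have hq : p ≤ CentreBlowup.degIn S d := by
      have h : CentreBlowup.ordAlong S F ≤ (CentreBlowup.degIn S d : ℕ∞) := Finset.inf_le hd
      exact_mod_cast hperm.trans h
    rw [coordBlowupSubst_zero_rename_monomial, X_pow_eq_monomial, monomial_mul, one_mul, ← add_assoc,
      ← Finsupp.single_add, Nat.add_sub_cancel' hq]

end Ring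

/-! ## §2 The controlled transform on the `z`-chart and its support -/

section ZChart

variable {K : Type} [Field K] {p : ℕ} [hp : Fact p.Prime]
variable {S : Finset (Fin 4)} {W : Scheme.{0}} {π : W ⟶ P 4 K}

/-- **The controlled transform on the `z`-chart of the model substitution**: `(ψ₀^*(z^p + F)·𝒪 : (z)^p) = (1 + T)·𝒪`.
[cite: BierstoneGrigorievMilmanWlodarczyk2011, §3.2 (controlled transform)] -/
theorem exists_controlledTransform_specMap_subst_zero (F : MvPolynomial (Fin 4) K)
    (hperm : (p : ℕ∞) ≤ CentreBlowup.ordAlong S F) :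
    ∃ T : MvPolynomial (Fin (4 + 1)) K,
      T ∈ Ideal.span ((fun j : Fin 4 => (X j.succ : MvPolynomial (Fin (4 + 1)) K)) '' (S : Set (Fin 4))) ∧
        controlledTransform
            (Spec.map (CommRingCat.ofHom
              (coordBlowupSubst K (insert 0 (Fin.succ '' (S : Set (Fin 4)))) 0).toRingHom))
            (AffineCoordBlowup.𝓘Λ 4 K (insert 0 (Fin.succ '' (S : Set (Fin 4))))) (hypSheaf p F) p =
          ofIdealTop (Ideal.span {(γ 4 K).symm (1 + T)}) := by
  obtain ⟨T, hT, hψ⟩ := exists_coordBlowupSubst_zero_hyp hp.out.ne_zero F hperm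
  refine ⟨T, hT, ?_⟩
  rw [controlledTransform, ChartDictionary.comap_𝓘Λ_specMap_subst (ChartDictionary.zero_mem_centreVars S),
    hypSheaf, ← ofIdealTop_pow, Ideal.span_singleton_pow, ChartDictionary.comap_ofIdealTop_span_γ_symm]
  change colon (ofIdealTop (Ideal.span {(γ 4 K).symm (coordBlowupSubst K _ 0 (hyp p F))})) _ = _
  rw [hψ, map_mul, map_pow]
  change colon (ofIdealTop (Ideal.span {coord 4 K 0 ^ p * (γ 4 K).symm (1 + T)}))
    (ofIdealTop (Ideal.span {coord 4 K 0 ^ p})) = _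
  rw [colon_ofIdealTop, ChartDictionary.colon_span_singleton_mul_eq
    (ChartDictionary.coord_pow_mem_nonZeroDivisors 0 p)]

/-- **The controlled transform on the `z`-chart of ANY blowing up** `π : W → 𝔸⁵_K` along `V(z, x_S)`:
`σᶜ((z^p + F)·𝒪, p)|_{W[⊤, z]} = (1 + T)·𝒪` with `T ∈ (xᵢ : i ∈ S)` (flat base change of the model square
`chartImm ≫ π = Spec ψ₀`). [cite: BierstoneGrigorievMilmanWlodarczyk2011, §3.2 and Lemma 8.0.3 (2)] -/
theorem exists_controlledTransform_comap_chartImm_zero (F : MvPolynomial (Fin 4) K)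
    (hperm : (p : ℕ∞) ≤ CentreBlowup.ordAlong S F)
    (hπ : IsBlowup π (AffineCoordBlowup.𝓘Λ 4 K (insert 0 (Fin.succ '' (S : Set (Fin 4)))))) :
    ∃ T : MvPolynomial (Fin (4 + 1)) K,
      T ∈ Ideal.span ((fun j : Fin 4 => (X j.succ : MvPolynomial (Fin (4 + 1)) K)) '' (S : Set (Fin 4))) ∧
        (controlledTransform π (AffineCoordBlowup.𝓘Λ 4 K (insert 0 (Fin.succ '' (S : Set (Fin 4)))))
            (hypSheaf p F) p).comap (AffineCoordBlowup.chartImm hπ (ChartDictionary.zero_mem_centreVars S)) =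
          ofIdealTop (Ideal.span {(γ 4 K).symm (1 + T)}) := by
  haveI : IsProper π := hπ.isProper
  haveI : IsLocallyNoetherian W := LocallyOfFiniteType.isLocallyNoetherian π
  obtain ⟨T, hT, hc⟩ := exists_controlledTransform_specMap_subst_zero (p := p) F hperm
  refine ⟨T, hT, ?_⟩
  have hsq : AffineCoordBlowup.chartImm hπ (ChartDictionary.zero_mem_centreVars S) ≫ π =
      Spec.map (CommRingCat.ofHom
        (coordBlowupSubst K (insert 0 (Fin.succ '' (S : Set (Fin 4)))) 0).toRingHom) ≫ 𝟙 (P 4 K) := by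
    rw [Category.comp_id]
    exact AffineCoordBlowup.chartImm_comp hπ (ChartDictionary.zero_mem_centreVars S)
  rw [comap_controlledTransform_of_flat (t := 𝟙 (P 4 K)) hsq, Scheme.IdealSheafData.comap_id,
    Scheme.IdealSheafData.comap_id, hc]

omit hp in
/-- The ideal sheaf `(γ⁻¹ g)·𝒪` of one polynomial `g` is the `SpecOrders` ideal sheaf `shf (g)`. [folklore] -/
theorem ofIdealTop_span_γ_symm_eq_shf (g : A 4 K) :
    ofIdealTop (Ideal.span {(γ 4 K).symm g}) = shf (A 4 K) (Ideal.span {g}) := by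
  rw [shf, Ideal.map_span, Set.image_singleton]
  rfl

omit hp in
/-- **Support of a principal ideal sheaf of `𝔸⁵`**: `1 ≤ ord_x ((γ⁻¹ g)·𝒪) ↔ g ∈ 𝔭_x`.
[cite: ZariskiSamuel1960, Vol. II Ch. VIII §1 (orders of ideals in local rings)] -/
theorem one_le_idealOrder_ofIdealTop_span_iff (g : A 4 K) (x : P 4 K) :
    1 ≤ idealOrder (ofIdealTop (Ideal.span {(γ 4 K).symm g})) x ↔ g ∈ x.asIdeal := by
  rw [one_le_idealOrder_iff, ofIdealTop_span_γ_symm_eq_shf,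
    Literature.AlgebraicGeometry.Hironaka2017.SpecOrders.mem_support_shf_iff, Ideal.span_singleton_le_iff_mem]

/-- **A point of the `z`-chart at which the controlled transform has positive order has `xⱼ ∉ 𝔭` for some
`j ∈ S`** — the direction `[z : x_S] = [1 : 0 : ⋯ : 0]` of the exceptional fibre is never on the transform
(`1 + T ∈ 𝔭` and `T ∈ (x_S) ⊆ 𝔭` would put `1` in the prime `𝔭`). [cite: Hauser2010, §F (points of the transform above the centre)] -/
theorem exists_X_succ_not_mem_of_one_le_idealOrder (F : MvPolynomial (Fin 4) K)
    (hperm : (p : ℕ∞) ≤ CentreBlowup.ordAlong S F)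
    (hπ : IsBlowup π (AffineCoordBlowup.𝓘Λ 4 K (insert 0 (Fin.succ '' (S : Set (Fin 4)))))) {x : P 4 K}
    (hord : 1 ≤ idealOrder (controlledTransform π
      (AffineCoordBlowup.𝓘Λ 4 K (insert 0 (Fin.succ '' (S : Set (Fin 4))))) (hypSheaf p F) p)
      (AffineCoordBlowup.chartImm hπ (ChartDictionary.zero_mem_centreVars S) x)) :
    ∃ j ∈ S, (X j.succ : A 4 K) ∉ x.asIdeal := by
  obtain ⟨T, hT, hc⟩ := exists_controlledTransform_comap_chartImm_zero (p := p) F hperm hπ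
  rw [← idealOrder_comap_of_isOpenImmersion (AffineCoordBlowup.chartImm hπ (ChartDictionary.zero_mem_centreVars S)),
    hc, one_le_idealOrder_ofIdealTop_span_iff] at hord
  by_contra hall
  push Not at hall
  have hTle : Ideal.span ((fun j : Fin 4 => (X j.succ : MvPolynomial (Fin (4 + 1)) K)) '' (S : Set (Fin 4))) ≤
      x.asIdeal := by
    rw [Ideal.span_le]
    rintro _ ⟨j, hj, rfl⟩
    exact hall j hj
  have h1 : (1 : A 4 K) ∈ x.asIdeal := by
    have := x.asIdeal.sub_mem hord (hTle hT)
    rwa [add_sub_cancel_right] at this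
  exact x.isPrime.ne_top ((Ideal.eq_top_iff_one _).mpr h1)

end ZChart

end Equimultiple

end Summit.ResolutionOfSingularities.ResolutionOfSingularities.Theorems.PIDim4

end
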